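import Literature.AlgebraicGeometry.Resolution.WeightedCentreHeavyBaseCase
import Literature.AlgebraicGeometry.Resolution.WeightedCentreFilteredDerivation
import HarnessLib

/-!
# The LEADING FLOW of a flow fixes the leading face (engine 1's `W(f)` toy model, step (L1′) (★′) — an instrument, NOT a
# resolution theorem)

RE-DERIVATION-eng1-g44 §3.3, step (L1′), the identity (★′): let `(𝔇, q)` be the data of a substitution
`Φ(T) : ε_i ↦ Σ_{b<p} u_b 𝔇^b(ε_i) T^b + q_i T^p` with `h(Φ(T)ε) = h` (`TailedLightFlow.substC`, (tf4)), and let `λ ≥ 0` be an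
auxiliary weight with a level `μ` such that every datum `𝔇ε_i` weighs `≥ λ_i + μ` and every tail `q_i` weighs `≥ λ_i + pμ`
(`LeadingForm.WtGE`).  Grade `k[ε][T]` by `λ` and `wt T := −μ`: then `Φ(T)` is weight-non-decreasing, its `λ`-LEADING PART is the
substitution `Φ_λ(T)` with data the LEADING DERIVATION `𝔇_λ = FilteredDerivation.lead λ 𝔇 μ` (whose iterates are the lowest
components of the iterates of `𝔇`, `FilteredDerivation.weightedHomogeneousComponent_iterate_X` = L9 (i)) and the leading tails
`q_{λ,i} = comp_{λ_i + pμ}(q_i)`, and THE LEADING-FORM PRINCIPLE (`LeadingForm.weightedHomogeneousComponent_aeval_of_wtGE`, L5)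
applied to `h(Φ(T)ε) = h` at `λ`-weight `0` gives

  **`substC_lead_component_zero`** : `h₀(Φ_λ(T)ε) = h₀`, `h₀ :=` the `λ`-weight-`0` component of `h`

(engine: "`h'(Φ_λ(T)ε') = h'`, `h' = h|_{Z″=0}`", with `λ` supported on `Z″`).  The `Option`-world bookkeeping (`T = X none`,
`famO` = `Φ(T)ε_j` read in `MvPolynomial (Option ι) k`, transport through Mathlib's `optionEquivLeft`) follows the tree's
`WeightedCentreHeavyBaseCase` (`fullFamily`, `optionEquivLeft_aeval_apply`).

HONEST FRAMING.  Graded commutative algebra over a commutative ring ([Lang2002, Ch. IV §1] weighted gradings and leading forms;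
[Matsumura1987, §27 (pp. 207–209), §25] truncated exponentials of derivations); statements OURS in this packaging; an instrument for
engine 1's `W(f)` TOY MODEL — NOT a resolution theorem, NOT a statement about the invariant of [AbramovichTemkinWlodarczyk2024].
-/

namespace Literature.AlgebraicGeometry.Resolution.WeightedBlowup

namespace TailedLightFlow

open Polynomial
open scoped Nat

section OptionFamily

variable {k : Type*} [CommRing k] {ι : Type*} (D : Derivation k (MvPolynomial ι k) (MvPolynomial ι k)) (p : ℕ) (u : ℕ → k)
  (q : ι → MvPolynomial ι k)

/-- `Φ(T)(ε_j) = Σ_{b<p} u_b 𝔇^b(ε_j) T^b + q_j T^p` READ IN `MvPolynomial (Option ι) k` (`T = X none`; construction, bookkeeping).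
[cite: Matsumura1987, §27 (pp. 207–209)] -/
noncomputable def famO (j : ι) : MvPolynomial (Option ι) k :=
  ∑ b ∈ Finset.range p, MvPolynomial.rename some (u b • D^[b] (MvPolynomial.X j)) * MvPolynomial.X none ^ b
    + MvPolynomial.rename some (q j) * MvPolynomial.X none ^ p

/-- `optionEquivLeft (famO j) = Φ(T)(ε_j)` (bookkeeping about Mathlib's `optionEquivLeft`). [cite: Matsumura1987, §27 (pp. 207–209)] -/
theorem optionEquivLeft_famO (j : ι) : MvPolynomial.optionEquivLeft k ι (famO D p u q j) = substC D p u q (MvPolynomial.X j) := by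
  rw [famO, substC_X, sigmaExp_X, map_add, map_sum, map_mul, map_pow, MvPolynomial.optionEquivLeft_X_none,
    VertexStep.optionEquivLeft_rename_some]
  refine congrArg (· + _) (Finset.sum_congr rfl fun b _ => ?_)
  rw [map_mul, map_pow, MvPolynomial.optionEquivLeft_X_none, VertexStep.optionEquivLeft_rename_some]

/-- `optionEquivLeft ∘ (ε ↦ famO) = Φ(T)` on all of `k[ε]` (bookkeeping). [cite: Matsumura1987, §27 (pp. 207–209)] -/
theorem optionEquivLeft_aeval_famO (P : MvPolynomial ι k) :
    MvPolynomial.optionEquivLeft k ι (MvPolynomial.aeval (famO D p u q) P) = substC D p u q P := by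
  rw [optionEquivLeft_aeval_apply]
  refine DFunLike.congr_fun (MvPolynomial.algHom_ext (fun i => ?_) : MvPolynomial.aeval _ = substC D p u q) P
  rw [MvPolynomial.aeval_X, optionEquivLeft_famO]

/-- **(tf4) in the `Option`-world**: `h(Φ(T)ε) = h` reads `aeval famO h = rename some h` (bookkeeping). [cite: Matsumura1987, §27 (pp. 207–209)] -/
theorem aeval_famO_eq_of_fix {G : MvPolynomial ι k} (hfix : substC D p u q G = C G) :
    MvPolynomial.aeval (famO D p u q) G = MvPolynomial.rename some G := by
  apply (MvPolynomial.optionEquivLeft k ι).injective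
  rw [optionEquivLeft_aeval_famO, VertexStep.optionEquivLeft_rename_some, hfix]

/-- Conversely `aeval famO h = rename some h` gives (tf4) (bookkeeping). [cite: Matsumura1987, §27 (pp. 207–209)] -/
theorem fix_of_aeval_famO_eq {G : MvPolynomial ι k} (h : MvPolynomial.aeval (famO D p u q) G = MvPolynomial.rename some G) :
    substC D p u q G = C G := by
  rw [← optionEquivLeft_aeval_famO, h, VertexStep.optionEquivLeft_rename_some]

end OptionFamily

/-! ## The leading flow -/

section LeadingFlow

open LeadingForm FilteredDerivation

variable {k : Type*} [CommRing k] {ι : Type*} [Fintype ι] [DecidableEq ι] (lam : ι → ℚ)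
  (D : Derivation k (MvPolynomial ι k) (MvPolynomial ι k)) (p : ℕ) (u : ℕ → k) (q : ι → MvPolynomial ι k) (μ : ℚ)

/-- The `Option`-world weight: `T = X none` weighs `−μ`, `ε_i` weighs `λ_i` (ours, bookkeeping). [cite: Lang2002, Ch. IV §1] -/
def lamO : Option ι → ℚ := fun o => o.elim (-μ) lam

omit [Fintype ι] [DecidableEq ι] in
/-- Bookkeeping. [cite: Lang2002, Ch. IV §1] -/
theorem lamO_comp_some : lamO lam μ ∘ some = lam := rfl

omit [Fintype ι] [DecidableEq ι] in
/-- Bookkeeping. [cite: Lang2002, Ch. IV §1] -/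
theorem lamO_none : lamO lam μ none = -μ := rfl

/-- The LEADING TAILS `q_{λ,i} := comp_{λ_i + pμ}(q_i)` (ours, construction). [cite: Lang2002, Ch. IV §1] -/
noncomputable def leadTail (i : ι) : MvPolynomial ι k := MvPolynomial.weightedHomogeneousComponent lam (lam i + p • μ) (q i)

/-- The REST of `Φ(T)ε_j` after its `λ`-leading part `Φ_λ(T)ε_j` (ours, bookkeeping). [cite: Lang2002, Ch. IV §1] -/
noncomputable def restO (j : ι) : MvPolynomial (Option ι) k :=
  ∑ b ∈ Finset.range p,
      MvPolynomial.rename some (u b • (D^[b] (MvPolynomial.X j) - (lead lam D μ)^[b] (MvPolynomial.X j))) * MvPolynomial.X none ^ b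
    + MvPolynomial.rename some (q j - leadTail lam p q μ j) * MvPolynomial.X none ^ p

omit [Fintype ι] [DecidableEq ι] in
/-- `Φ(T)ε_j = Φ_λ(T)ε_j + rest_j` in the `Option`-world (bookkeeping). [cite: Lang2002, Ch. IV §1] -/
theorem famO_lead_add_restO (j : ι) :
    famO (lead lam D μ) p u (leadTail lam p q μ) j + restO lam D p u q μ j = famO D p u q j := by
  simp only [famO, restO]
  rw [add_add_add_comm, ← Finset.sum_add_distrib, ← add_mul, ← map_add, add_sub_cancel]
  refine congrArg (· + _) (Finset.sum_congr rfl fun b _ => ?_)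
  rw [← add_mul, ← map_add, ← smul_add, add_sub_cancel]

omit [Fintype ι] [DecidableEq ι] in
/-- Transport of weak lower weight bounds along `rename some` (ours, bookkeeping; cf. `LemmaL.wtGT_rename_some`).
[cite: Lang2002, Ch. IV §1] -/
theorem wtGE_rename_some {wt : Option ι → ℚ} {ω : ι → ℚ} (hcomp : wt ∘ some = ω) {f : MvPolynomial ι k} {n : ℚ}
    (hf : WtGE ω n f) : WtGE wt n (MvPolynomial.rename some f) := by
  classical
  intro d hd
  rw [MvPolynomial.support_rename_of_injective (Option.some_injective ι)] at hd
  obtain ⟨m, hm, rfl⟩ := Finset.mem_image.mp hd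
  rw [VertexStep.weight_mapDomain, hcomp]
  exact hf m hm

omit [Fintype ι] [DecidableEq ι] in
/-- Removing the lowest component raises the filtration strictly: `WtGE n P ⟹ WtGT n (P − comp_n P)` (ours, bookkeeping).
[cite: Lang2002, Ch. IV §1] -/
theorem wtGT_sub_weightedHomogeneousComponent {ω : ι → ℚ} {n : ℚ} {P : MvPolynomial ι k} (hP : WtGE ω n P) :
    WtGT ω n (P - MvPolynomial.weightedHomogeneousComponent ω n P) := by
  intro m hm
  have hc : MvPolynomial.coeff m (P - MvPolynomial.weightedHomogeneousComponent ω n P) ≠ 0 := MvPolynomial.mem_support_iff.mp hm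
  rw [MvPolynomial.coeff_sub, MvPolynomial.coeff_weightedHomogeneousComponent] at hc
  by_cases h : Finsupp.weight ω m = n
  · rw [if_pos h, sub_self] at hc
    exact absurd rfl hc
  · rw [if_neg h, sub_zero] at hc
    exact lt_of_le_of_ne (hP m (MvPolynomial.mem_support_iff.mpr hc)) (Ne.symm h)

omit [Fintype ι] in
/-- A scalar multiple keeps a strict lower weight bound (bookkeeping). [cite: Lang2002, Ch. IV §1] -/
theorem _root_.Literature.AlgebraicGeometry.Resolution.WeightedBlowup.LeadingForm.WtGT.smul {ω : ι → ℚ} {n : ℚ}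
    {P : MvPolynomial ι k} (hP : WtGT ω n P) (c : k) : WtGT ω n (c • P) := by
  rw [MvPolynomial.smul_eq_C_mul]
  exact hP.C_mul c

omit [Fintype ι] [DecidableEq ι] in
/-- A scalar multiple keeps weighted homogeneity (bookkeeping). [cite: Lang2002, Ch. IV §1] -/
theorem _root_.MvPolynomial.IsWeightedHomogeneous.smul' {ω : ι → ℚ} {n : ℚ} {P : MvPolynomial ι k}
    (hP : MvPolynomial.IsWeightedHomogeneous ω P n) (c : k) : MvPolynomial.IsWeightedHomogeneous ω (c • P) n := by
  rw [MvPolynomial.smul_eq_C_mul]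
  exact hP.C_mul c

/-- **The leading family is homogeneous of the slot weight** (ours): for `wt T = −μ`, `Φ_λ(T)ε_j = Σ_b u_b 𝔇_λ^b(ε_j) T^b +
q_{λ,j} T^p` is `λ̃`-homogeneous of weight `λ_j` — `𝔇_λ^b(ε_j)` is the component of weight `λ_j + bμ` of `𝔇^b(ε_j)` (L9 (i)).
[cite: Lang2002, Ch. IV §1] [cite: Matsumura1987, §25] -/
theorem isWeightedHomogeneous_famO_lead (hD : ∀ i, WtGE lam (lam i + μ) (D (MvPolynomial.X i))) (j : ι) :
    MvPolynomial.IsWeightedHomogeneous (lamO lam μ) (famO (lead lam D μ) p u (leadTail lam p q μ) j) (lamO lam μ (some j)) := by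
  have hXn : MvPolynomial.IsWeightedHomogeneous (lamO lam μ) (MvPolynomial.X none : MvPolynomial (Option ι) k) (-μ) :=
    MvPolynomial.isWeightedHomogeneous_X k _ none
  refine (MvPolynomial.IsWeightedHomogeneous.sum _ _ _ fun b _ => ?_).add ?_
  · have h1 : MvPolynomial.IsWeightedHomogeneous lam ((lead lam D μ)^[b] (MvPolynomial.X j)) (lam j + b • μ) := by
      rw [← weightedHomogeneousComponent_iterate_X lam D μ hD j b]
      exact MvPolynomial.weightedHomogeneousComponent_isWeightedHomogeneous _ _
    have h2 := (LemmaL.isWeightedHomogeneous_rename_some (K := k) (lamO_comp_some lam μ) (h1.smul' (u b))).mul (hXn.pow b)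
    have e : lam j + b • μ + b • (-μ) = lamO lam μ (some j) := by
      show lam j + b • μ + b • (-μ) = lam j
      rw [smul_neg, add_neg_cancel_right]
    rwa [e] at h2
  · have h1 : MvPolynomial.IsWeightedHomogeneous lam (leadTail lam p q μ j) (lam j + p • μ) :=
      MvPolynomial.weightedHomogeneousComponent_isWeightedHomogeneous _ _
    have h2 := (LemmaL.isWeightedHomogeneous_rename_some (K := k) (lamO_comp_some lam μ) h1).mul (hXn.pow p)
    have e : lam j + p • μ + p • (-μ) = lamO lam μ (some j) := by
      show lam j + p • μ + p • (-μ) = lam j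
      rw [smul_neg, add_neg_cancel_right]
    rwa [e] at h2

/-- **The rest weighs strictly more than the slot** (ours): every monomial of `Φ(T)ε_j − Φ_λ(T)ε_j` has `λ̃`-weight `> λ_j` when the
data weigh `≥ λ_i + μ` and the tails `≥ λ_i + pμ`. [cite: Lang2002, Ch. IV §1] [cite: Matsumura1987, §25] -/
theorem wtGT_restO (hD : ∀ i, WtGE lam (lam i + μ) (D (MvPolynomial.X i))) (hq : ∀ i, WtGE lam (lam i + p • μ) (q i)) (j : ι) :
    WtGT (lamO lam μ) (lamO lam μ (some j)) (restO lam D p u q μ j) := by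
  have hXn : MvPolynomial.IsWeightedHomogeneous (lamO lam μ) (MvPolynomial.X none : MvPolynomial (Option ι) k) (-μ) :=
    MvPolynomial.isWeightedHomogeneous_X k _ none
  refine (WtGT.sum _ _ fun b _ => ?_).add ?_
  · have h1 : WtGT lam (lam j + b • μ) (u b • (D^[b] (MvPolynomial.X j) - (lead lam D μ)^[b] (MvPolynomial.X j))) := by
      rw [← weightedHomogeneousComponent_iterate_X lam D μ hD j b]
      exact (wtGT_sub_weightedHomogeneousComponent (wtGE_iterate_X lam D μ hD j b)).smul (u b)
    have h2 := (LemmaL.wtGT_rename_some (K := k) (lamO_comp_some lam μ) h1).mul_wtGE (wtGE_of_isWeightedHomogeneous (hXn.pow b))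
    have e : lam j + b • μ + b • (-μ) = lamO lam μ (some j) := by
      show lam j + b • μ + b • (-μ) = lam j
      rw [smul_neg, add_neg_cancel_right]
    rwa [e] at h2
  · have h1 : WtGT lam (lam j + p • μ) (q j - leadTail lam p q μ j) := wtGT_sub_weightedHomogeneousComponent (hq j)
    have h2 := (LemmaL.wtGT_rename_some (K := k) (lamO_comp_some lam μ) h1).mul_wtGE (wtGE_of_isWeightedHomogeneous (hXn.pow p))
    have e : lam j + p • μ + p • (-μ) = lamO lam μ (some j) := by
      show lam j + p • μ + p • (-μ) = lam j
      rw [smul_neg, add_neg_cancel_right]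
    rwa [e] at h2

omit [Fintype ι] [DecidableEq ι] in
/-- An `Option`-world family from its value at `T` and its values at the `ε_j` (ours, bookkeeping; kept GENERIC so that no kernel
unfolding of the concrete families is ever needed). [cite: Lang2002, Ch. IV §1] -/
def optFam {A : Type*} (T : A) (f : ι → A) : Option ι → A := fun o => o.elim T f

omit [Fintype ι] [DecidableEq ι] in
/-- Bookkeeping. [cite: Lang2002, Ch. IV §1] -/
@[simp] theorem optFam_none {A : Type*} (T : A) (f : ι → A) : optFam T f none = T := rfl

omit [Fintype ι] [DecidableEq ι] in
/-- Bookkeeping. [cite: Lang2002, Ch. IV §1] -/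
@[simp] theorem optFam_some {A : Type*} (T : A) (f : ι → A) (j : ι) : optFam T f (some j) = f j := rfl

omit [Fintype ι] [DecidableEq ι] in
/-- Bookkeeping. [cite: Lang2002, Ch. IV §1] -/
theorem optFam_comp_some {A : Type*} (T : A) (f : ι → A) : optFam T f ∘ some = f := rfl

omit [Fintype ι] [DecidableEq ι] in
/-- Bookkeeping: pointwise sum of two `Option`-world families. [cite: Lang2002, Ch. IV §1] -/
theorem optFam_add_optFam {A : Type*} [Add A] (T T' : A) (f g : ι → A) :
    (fun o => optFam T f o + optFam T' g o) = optFam (T + T') (fun j => f j + g j) := by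
  funext o
  cases o <;> rfl

/-- The leading family `T ↦ T, ε_j ↦ Φ_λ(T)ε_j` is homogeneous of the slot weights and the rest family `T ↦ 0, ε_j ↦ rest_j` weighs
strictly more (bookkeeping over `isWeightedHomogeneous_famO_lead` / `wtGT_restO`). [cite: Lang2002, Ch. IV §1] -/
theorem optFam_graded (hD : ∀ i, WtGE lam (lam i + μ) (D (MvPolynomial.X i))) (hq : ∀ i, WtGE lam (lam i + p • μ) (q i)) :
    (∀ o, MvPolynomial.IsWeightedHomogeneous (lamO lam μ)
        (optFam (MvPolynomial.X none) (famO (lead lam D μ) p u (leadTail lam p q μ)) o) (lamO lam μ o)) ∧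
      ∀ o, WtGT (lamO lam μ) (lamO lam μ o) (optFam (0 : MvPolynomial (Option ι) k) (restO lam D p u q μ) o) := by
  refine ⟨?_, ?_⟩
  · rintro (_ | j)
    · rw [optFam_none]
      exact MvPolynomial.isWeightedHomogeneous_X k _ none
    · rw [optFam_some]
      exact isWeightedHomogeneous_famO_lead lam D p u q μ hD j
  · rintro (_ | j)
    · rw [optFam_none]
      exact wtGT_zero _
    · rw [optFam_some]
      exact wtGT_restO lam D p u q μ hD hq j

/-- **L5 applied**: the `λ̃`-weight-`0` component of `h` is fixed by the leading family (derived here).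
[cite: Lang2002, Ch. IV §1] [cite: Matsumura1987, §27 (pp. 207–209)] -/
theorem aeval_leadFamO_component_zero (hlam : ∀ i, 0 ≤ lam i) (hD : ∀ i, WtGE lam (lam i + μ) (D (MvPolynomial.X i)))
    (hq : ∀ i, WtGE lam (lam i + p • μ) (q i)) {G : MvPolynomial ι k} (hfix : substC D p u q G = C G) :
    MvPolynomial.aeval (famO (lead lam D μ) p u (leadTail lam p q μ)) (MvPolynomial.weightedHomogeneousComponent lam 0 G)
      = MvPolynomial.rename some (MvPolynomial.weightedHomogeneousComponent lam 0 G) := by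
  obtain ⟨ha, hb⟩ := optFam_graded lam D p u q μ hD hq
  have hG : WtGE (lamO lam μ) 0 (MvPolynomial.rename some G) :=
    wtGE_rename_some (lamO_comp_some lam μ) (LemmaL.wtGE_zero_of_nonneg hlam G)
  have key := weightedHomogeneousComponent_aeval_of_wtGE (n := 0) ha hb hG
  have hsum : (fun j => famO (lead lam D μ) p u (leadTail lam p q μ) j + restO lam D p u q μ j) = famO D p u q :=
    funext (famO_lead_add_restO lam D p u q μ)
  have hfull : MvPolynomial.aeval (fun o => optFam (MvPolynomial.X none) (famO (lead lam D μ) p u (leadTail lam p q μ)) o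
        + optFam (0 : MvPolynomial (Option ι) k) (restO lam D p u q μ) o) (MvPolynomial.rename some G)
      = MvPolynomial.rename some G := by
    rw [optFam_add_optFam, hsum, MvPolynomial.aeval_rename, optFam_comp_some]
    exact aeval_famO_eq_of_fix D p u q hfix
  rw [hfull, LemmaL.weightedHomogeneousComponent_rename_some (K := k) (lamO_comp_some lam μ), MvPolynomial.aeval_rename,
    optFam_comp_some] at key
  exact key.symm

/-- **THE LEADING FLOW FIXES THE LEADING FACE** (RE-DERIVATION-eng1-g44 §3.3 (L1′) (★′); derived here): if `h(Φ(T)ε) = h` for the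
data `(𝔇, q)`, `λ ≥ 0`, the data weigh `≥ λ_i + μ` and the tails `≥ λ_i + pμ`, then the leading data `(𝔇_λ, q_λ)` satisfy
`h₀(Φ_λ(T)ε) = h₀` for the `λ`-weight-`0` component `h₀` of `h` — the leading-form principle for the grading `wt T = −μ`.
[cite: Lang2002, Ch. IV §1] [cite: Matsumura1987, §27 (pp. 207–209)] -/
theorem substC_lead_component_zero (hlam : ∀ i, 0 ≤ lam i) (hD : ∀ i, WtGE lam (lam i + μ) (D (MvPolynomial.X i)))
    (hq : ∀ i, WtGE lam (lam i + p • μ) (q i)) {G : MvPolynomial ι k} (hfix : substC D p u q G = C G) :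
    substC (lead lam D μ) p u (leadTail lam p q μ) (MvPolynomial.weightedHomogeneousComponent lam 0 G)
      = C (MvPolynomial.weightedHomogeneousComponent lam 0 G) :=
  fix_of_aeval_famO_eq _ p u _ (aeval_leadFamO_component_zero lam D p u q μ hlam hD hq hfix)

end LeadingFlow

end TailedLightFlow

end Literature.AlgebraicGeometry.Resolution.WeightedBlowup
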